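import Literature.AlgebraicGeometry.HodgeTheory.SupportedClassesSemipurity
import Literature.AlgebraicTopology.SingularHomology.LocallyFlatCriticalDegree
import Literature.NumberTheory.Transcendental.AnalytificationConnectedOpen
import HarnessLib

/-!
# Purity of the coniveau pieces: the classes supported on ONE irreducible subvariety of codimension `c` form a line (or zero) in `H²ᶜ(X(ℂ); ℂ)`

Family `hodge`, layer `Literature/AlgebraicGeometry/HodgeTheory`. W. Fulton, *Intersection Theory*
(1998), §19.1, Lemma 19.1.1 with eq. (3) `H²ᶜ(X, X − V) ≅ H_{2n−2c}(V)`: for `V` irreducible of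
codimension `c` in the smooth projective `n`-fold `X`, the group `H²ᶜ(X, X − V)` is free of rank one
on the class of `V`, so `ker (H²ᶜ(X) → H²ᶜ(X − V)) = ℂ · cl(V)`; C. Voisin, *Hodge Theory I* (2002),
§11.1.2 (Lemma 11.13, Thm. 11.11). This is ingredient (i) "purity" of the moving hypothesis of
`HodgeTheory/AlgebraicClassesCup` (`cupProduct_mem_algebraicClasses_of_moving`, module docstring:
"(i) purity — `ker(H²ˡ(X(ℂ)) → H²ˡ((X ∖ Z)(ℂ)))` is spanned by the classes `cl(Zⱼ)` of the
codimension-`l` components of `Z`"), on the tree's carriers and WITHOUT constructing a cycle class: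

* `exists_ker_restrictCompl_le_span_of_isIrreducible` — **for `X` smooth projective over `ℂ`, `V ⊆ X`
  closed irreducible with every point of codimension `≥ c ≥ 1`, there is ONE class `τ_V ∈ H²ᶜ(X(ℂ); ℂ)`
  with `ker (H²ᶜ(X(ℂ); ℂ) → H²ᶜ((X ∖ V)(ℂ); ℂ)) ≤ ℂ · τ_V`** (in print `τ_V = cl(V)`, or `0` when
  `codim V > c`);
* `finrank_ker_restrictCompl_le_one_of_isIrreducible` — hence that kernel has dimension `≤ 1`.

Together with `algebraicClasses_eq_iSup_isIrreducible` (`SupportedClassesIrreducible`) this says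
`algebraicClasses X c = Nᶜ H²ᶜ(X(ℂ); ℂ) = Σ_V ℂ · τ_V` over the irreducible closed `V` of codimension `c`
— the printed description "the `ℂ`-span of the cycle classes" of `HodgeTheory/AlgebraicClasses`, with
`τ_V` in the rôle of `cl(V)`.

## Proof (everything PROVED)

Off a Zariski-closed `Z₁ ⊆ V` of codimension `≥ c + 1` the set `V(ℂ)` is straightened in `X(ℂ)` by
charts `X(ℂ) ⇀ ℂ^{c'} × K`, `c' ≥ c` (Serre, GAGA §6 Cor. 3 at simple points; the tree's
`GAGADimension.exists_closed_straightening_off`). On the open subspace `U = (X ∖ Z₁)(ℂ)` the closed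
subset `S = (V ∖ Z₁)(ℂ)` is connected (Shafarevich VII §2 Thm. 7.1; the tree's
`ComplexPoints.isConnected_setOf_pt_mem_inter_of_isIrreducible`) and locally flat of real codimension
`≥ 2c`, so `H_{2c}(U, U ∖ S; ℂ) = ℂ · θ` (the topological Thom class,
`exists_forall_mem_span_localHomologyOfSet_of_locallyFlat`, file
`SingularHomology/LocallyFlatCriticalDegree`), whence `ker (H²ᶜ(U) → H²ᶜ(U ∖ S)) ≤ ℂ · τ_U`
(universal coefficients, `exists_ker_cohomologyMap_le_span_of_localHomologyOfSet`). Finally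
`H²ᶜ(X(ℂ)) → H²ᶜ(U)` is one-to-one (semipurity across `Z₁`, `injective_restrictCompl_of_le_coheight`,
`2c < 2(c+1)`) and `U ∖ S = (X ∖ V)(ℂ)`, so the kernel on `X` embeds in the kernel on `U`.

## References

* [Fulton1998] W. Fulton, Intersection Theory, 2nd ed. (Springer 1998), §19.1 eq. (3) and
  Lemma 19.1.1.
* [VoisinHodgeI2002] C. Voisin, Hodge Theory and Complex Algebraic Geometry I, CUP 2002, §11.1.1
  Thm. 11.11, §11.1.2 Lemma 11.13.
* [SerreGAGA1956] J.-P. Serre, GAGA, Ann. Inst. Fourier 6 (1956), §6 Prop. 3 Cor. 3.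
* [Shafarevich1994] I. R. Shafarevich, Basic Algebraic Geometry 2, Book 3 Ch. VII §2 Thm. 7.1.
* [GrothendieckTopology1969] A. Grothendieck, Hodge's general conjecture is false for trivial
  reasons, Topology 8 (1969), §1.
-/

noncomputable section

open CategoryTheory AlgebraicGeometry Set TopologicalSpace
open Literature.AlgebraicTopology.SingularHomology

namespace Literature.AlgebraicGeometry.HodgeTheory

section HodgeTheory

/-! ### Linear algebra: lines pull back to lines along one-to-one maps -/

/-- If a subspace `K` is carried by a one-to-one linear map into a line `F · τ`, then `K` itself lies
in a line `F · v`. [folklore] -/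
theorem exists_le_span_singleton_of_injective {F : Type*} [Field F] {V W : Type*} [AddCommGroup V]
    [Module F V] [AddCommGroup W] [Module F W] (f : V →ₗ[F] W) (hf : Function.Injective f)
    (K : Submodule F V) (τ : W) (h : ∀ x ∈ K, f x ∈ Submodule.span F ({τ} : Set W)) :
    ∃ v : V, K ≤ Submodule.span F {v} := by
  by_cases hK : K = ⊥
  · exact ⟨0, by rw [hK]; exact bot_le⟩
  obtain ⟨x₀, hx₀K, hx₀⟩ := (Submodule.ne_bot_iff _).1 hK
  refine ⟨x₀, fun x hx ↦ ?_⟩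
  obtain ⟨a, ha⟩ := Submodule.mem_span_singleton.1 (h x₀ hx₀K)
  obtain ⟨b, hb⟩ := Submodule.mem_span_singleton.1 (h x hx)
  have ha0 : a ≠ 0 := by
    rintro rfl
    rw [zero_smul, eq_comm] at ha
    exact hx₀ (hf (by rw [ha, map_zero]))
  refine Submodule.mem_span_singleton.2 ⟨b / a, hf ?_⟩
  rw [map_smul, ← ha, smul_smul, div_mul_cancel₀ b ha0, hb]

/-! ### Purity for one irreducible subvariety -/

variable {n : ℕ} {X : Motives.SchemeOver ℂ}

/-- **Purity of the coniveau piece of ONE irreducible subvariety** (Fulton 1998, §19.1 Lemma 19.1.1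
with eq. (3): `ker (H²ᶜ(X) → H²ᶜ(X − V)) = im H²ᶜ(X, X − V) = ℂ · cl(V)` for `V` irreducible of
codimension `c`). For `X` smooth projective over `ℂ`, `V ⊆ X` Zariski-closed and irreducible with
every point of codimension `≥ c`, `c ≥ 1`, there is a class `τ ∈ H²ᶜ(X(ℂ); ℂ)` such that every class
of `H²ᶜ(X(ℂ); ℂ)` vanishing on `(X ∖ V)(ℂ)` is a multiple of `τ`. Proof: straighten `V(ℂ)` off a
closed `Z₁ ⊆ V` of codimension `≥ c + 1` (`GAGADimension.exists_closed_straightening_off`); on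
`U = (X ∖ Z₁)(ℂ)` the straightened part `S = (V ∖ Z₁)(ℂ)` is closed, connected
(`ComplexPoints.isConnected_setOf_pt_mem_inter_of_isIrreducible`) and locally flat of real
codimension `≥ 2c`, so `H_{2c}(U | S; ℂ)` is a line (`exists_forall_mem_span_localHomologyOfSet_of_locallyFlat`)
and the classes of `H²ᶜ(U)` dying on `U ∖ S = (X ∖ V)(ℂ)` lie on a line
(`exists_ker_cohomologyMap_le_span_of_localHomologyOfSet`); `H²ᶜ(X(ℂ)) → H²ᶜ(U)` is one-to-one
(`injective_restrictCompl_of_le_coheight`). If `V ⊆ Z₁` the kernel is already `0` by semipurity.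
[cite: Fulton1998, §19.1 Lemma 19.1.1 and eq. (3)] [cite: VoisinHodgeI2002, §11.1.2 Lemma 11.13 and §11.1.1 Thm. 11.11]
[cite: SerreGAGA1956, §6 Prop. 3 Cor. 3] [cite: Shafarevich1994, Book 3 Ch. VII §2 Thm. 7.1] -/
theorem exists_ker_restrictCompl_le_span_of_isIrreducible (hX : Motives.IsSmoothProjective n X)
    {V : Set X.left} (hV : IsClosed V) (hVi : IsIrreducible V) {c : ℕ} (hc : 1 ≤ c)
    (hcV : ∀ v ∈ V, (c : ℕ∞) ≤ Order.coheight v) :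
    ∃ τ : complexBetti X (2 * c),
      LinearMap.ker (complexBetti.restrictCompl X V (2 * c)).hom ≤ Submodule.span ℂ {τ} := by
  -- instances on `X(ℂ)`
  haveI := hX.smoothOfRelativeDimension
  haveI : LocallyOfFiniteType X.hom := by
    haveI : Smooth X.hom := SmoothOfRelativeDimension.smooth n _
    infer_instance
  haveI := Motives.IsSmoothProjective.compactSpace_holds hX
  haveI : SecondCountableTopology (Motives.ComplexPoints X) :=
    Motives.ComplexPoints.secondCountableTopology_of_compactSpace_holds X
  -- the bad set `Z₁` and the straightening charts off it
  obtain ⟨Z₁, hZ₁, hZ₁V, hcZ₁, hstr⟩ := GAGADimension.exists_closed_straightening_off hX hV hcV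
  -- if `V ⊆ Z₁`, every point of `V` has codimension `≥ c + 1` and the kernel vanishes (semipurity)
  by_cases hVZ : V ⊆ Z₁
  · refine ⟨0, fun x hx ↦ ?_⟩
    have hinj := injective_restrictCompl_of_le_coheight hX hV (fun v hv ↦ hcZ₁ v (hVZ hv))
      (i := 2 * c) (by omega)
    have h0 : x = 0 := hinj (by rw [LinearMap.mem_ker.1 hx, map_zero])
    rw [h0]
    exact Submodule.zero_mem _
  -- the open subspace `U = (X ∖ Z₁)(ℂ)` and its closed subset `S = (V ∖ Z₁)(ℂ)`
  have hO : IsOpen {P : Motives.ComplexPoints X | P.pt ∉ Z₁} :=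
    Motives.AlgPoints.isOpen_setOf_pt_mem (X := X) (L := ℂ) ⟨Z₁ᶜ, hZ₁.isOpen_compl⟩
  set S : Set (Motives.complexPointsCompl X Z₁) := {Q | Q.1.pt ∈ V} with hSdef
  have hS : IsClosed S := by
    have h1 : IsClosed {P : Motives.ComplexPoints X | P.pt ∈ V} :=
      ⟨Motives.AlgPoints.isOpen_setOf_pt_mem (X := X) (L := ℂ) ⟨Vᶜ, hV.isOpen_compl⟩⟩
    exact h1.preimage continuous_subtype_val
  -- `S` is connected: it is `(V ∖ Z₁)(ℂ)` read in the subspace `U`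
  have hSc : IsPreconnected S := by
    have hconn := Motives.ComplexPoints.isConnected_setOf_pt_mem_inter_of_isIrreducible X hV hVi
      ⟨Z₁ᶜ, hZ₁.isOpen_compl⟩ (by
        obtain ⟨z, hzV, hzZ⟩ := not_subset.1 hVZ
        exact ⟨z, hzV, hzZ⟩)
    have himg : (Subtype.val : Motives.complexPointsCompl X Z₁ → Motives.ComplexPoints X) '' S =
        {P : Motives.ComplexPoints X | P.pt ∈ V ∧ P.pt ∈ ((⟨Z₁ᶜ, hZ₁.isOpen_compl⟩ :
          X.left.Opens) : Set X.left)} := by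
      ext P
      constructor
      · rintro ⟨Q, hQ, rfl⟩
        exact ⟨hQ, Q.2⟩
      · rintro ⟨hPV, hPZ⟩
        exact ⟨⟨P, hPZ⟩, hPV, rfl⟩
    have hind : Topology.IsInducing
        (Subtype.val : Motives.complexPointsCompl X Z₁ → Motives.ComplexPoints X) := ⟨rfl⟩
    rw [← hind.isPreconnected_image, himg]
    exact hconn.isPreconnected
  -- local flatness of `S` in `U`, of real codimension `≥ 2c`
  have hflat : ∀ x ∈ S, ∃ (F : Type) (_ : NormedAddCommGroup F) (_ : NormedSpace ℝ F)
      (_ : FiniteDimensional ℝ F) (K : Type) (_ : NormedAddCommGroup K) (_ : NormedSpace ℝ K)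
      (e : OpenPartialHomeomorph (Motives.complexPointsCompl X Z₁) (F × K)),
      2 * c ≤ Module.finrank ℝ F ∧ x ∈ e.source ∧ ∀ z ∈ e.source, z ∈ S ↔ (e z).1 = 0 := by
    intro x hx
    obtain ⟨c', K, e, hcc', hxe, he⟩ := hstr x.1 hx x.2
    let s : Opens (Motives.ComplexPoints X) := ⟨{P | P.pt ∉ Z₁}, hO⟩
    let e' : OpenPartialHomeomorph (Motives.complexPointsCompl X Z₁) ((Fin c' → ℂ) × ↥K) :=
      e.subtypeRestr (s := s) ⟨x⟩
    have he's : e'.source = Subtype.val ⁻¹' e.source := OpenPartialHomeomorph.subtypeRestr_source e ⟨x⟩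
    have he'a : ∀ z : Motives.complexPointsCompl X Z₁, e' z = e z.1 := fun z ↦ rfl
    refine ⟨Fin c' → ℂ, inferInstance, inferInstance, inferInstance, ↥K, inferInstance,
      inferInstance, e', ?_, ?_, fun z hz ↦ ?_⟩
    · have hfr : Module.finrank ℝ (Fin c' → ℂ) = 2 * c' := by
        rw [Module.finrank_pi_fintype, Finset.sum_const, Finset.card_univ, Fintype.card_fin,
          Complex.finrank_real_complex, smul_eq_mul, mul_comm]
      rw [hfr]
      omega
    · rw [he's]
      exact hxe
    · rw [he's] at hz
      rw [he'a]
      exact he z.1 hz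
  -- the topological Thom class: `H_{2c}(U | S; ℂ)` is a line, hence so is `ker (H²ᶜ(U) → H²ᶜ(U ∖ S))`
  haveI : SecondCountableTopology (Motives.complexPointsCompl X Z₁) :=
    inferInstanceAs (SecondCountableTopology ↥{P : Motives.ComplexPoints X | P.pt ∉ Z₁})
  have hθ := exists_forall_mem_span_localHomologyOfSet_of_locallyFlat ℂ hS hSc (k := 2 * c)
    (by omega) hflat
  obtain ⟨τU, hτU⟩ := exists_ker_cohomologyMap_le_span_of_localHomologyOfSet ℂ S (2 * c) hθ
  -- `H²ᶜ(X(ℂ)) → H²ᶜ(U)` is one-to-one (semipurity across `Z₁`)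
  have hinj := injective_restrictCompl_of_le_coheight hX hZ₁ hcZ₁ (i := 2 * c) (by omega)
  -- `U ∖ S = (X ∖ V)(ℂ)` and the factorisation of the restriction to `(X ∖ V)(ℂ)` through `U`
  let g : ↥Sᶜ ≃ₜ Motives.complexPointsCompl X V :=
    { toFun := fun Q ↦ ⟨Q.1.1, Q.2⟩
      invFun := fun P ↦ ⟨⟨P.1, fun h ↦ P.2 (hZ₁V h)⟩, P.2⟩
      left_inv := fun _ ↦ rfl
      right_inv := fun _ ↦ rfl
      continuous_toFun := by fun_prop
      continuous_invFun := by fun_prop }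
  have hfac : complexBetti.restrictCompl X V (2 * c) = complexBetti.restrictCompl X Z₁ (2 * c) ≫
      singularCohomology.map ℂ ℂ (subsetIncl Sᶜ) (2 * c) ≫
        singularCohomology.map ℂ ℂ (g.symm : C(Motives.complexPointsCompl X V, ↥Sᶜ)) (2 * c) := by
    rw [complexBetti.restrictCompl, complexBetti.restrictCompl, ← singularCohomology.map_comp,
      ← singularCohomology.map_comp]
    rfl
  have hginj : Function.Injective
      (singularCohomology.map ℂ ℂ (g.symm : C(Motives.complexPointsCompl X V, ↥Sᶜ)) (2 * c)) :=
    ((forget (ModuleCat ℂ)).mapIso (singularCohomology.mapIso ℂ ℂ g.symm (2 * c))).toEquiv.injective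
  -- pull the line back along the one-to-one restriction
  refine exists_le_span_singleton_of_injective (complexBetti.restrictCompl X Z₁ (2 * c)).hom hinj
    _ τU fun x hx ↦ hτU ?_
  rw [LinearMap.mem_ker]
  apply hginj
  rw [map_zero]
  have hx' : complexBetti.restrictCompl X V (2 * c) x = 0 := LinearMap.mem_ker.1 hx
  rw [hfac, ModuleCat.comp_apply, ModuleCat.comp_apply] at hx'
  exact hx'

/-- **The classes supported on one irreducible subvariety of codimension `≥ c` span at most a line**:
`dim_ℂ ker (H²ᶜ(X(ℂ); ℂ) → H²ᶜ((X ∖ V)(ℂ); ℂ)) ≤ 1` for `X` smooth projective over `ℂ`, `V` closed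
irreducible with every point of codimension `≥ c ≥ 1` (Fulton 1998, §19.1 Lemma 19.1.1: the kernel is
`ℂ · cl(V)`). [cite: Fulton1998, §19.1 Lemma 19.1.1 and eq. (3)] -/
theorem finrank_ker_restrictCompl_le_one_of_isIrreducible (hX : Motives.IsSmoothProjective n X)
    {V : Set X.left} (hV : IsClosed V) (hVi : IsIrreducible V) {c : ℕ} (hc : 1 ≤ c)
    (hcV : ∀ v ∈ V, (c : ℕ∞) ≤ Order.coheight v) :
    Module.finrank ℂ (LinearMap.ker (complexBetti.restrictCompl X V (2 * c)).hom) ≤ 1 := by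
  obtain ⟨τ, hτ⟩ := exists_ker_restrictCompl_le_span_of_isIrreducible hX hV hVi hc hcV
  haveI : Module.Finite ℂ (Submodule.span ℂ ({τ} : Set (complexBetti X (2 * c)))) :=
    Module.Finite.span_of_finite ℂ (Set.finite_singleton τ)
  calc Module.finrank ℂ (LinearMap.ker (complexBetti.restrictCompl X V (2 * c)).hom)
      ≤ Module.finrank ℂ (Submodule.span ℂ ({τ} : Set (complexBetti X (2 * c)))) :=
        Submodule.finrank_mono hτ
    _ ≤ ({τ} : Set (complexBetti X (2 * c))).toFinset.card := finrank_span_le_card _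
    _ ≤ 1 := by simp

end HodgeTheory

end Literature.AlgebraicGeometry.HodgeTheory

end
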